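import Literature.IUT.HodgeArakelov.ThetaGauChainNonVacuity
import Mathlib.Data.Finite.Sigma
import Mathlib.Data.Finite.Prod
import HarnessLib

/-!
# [IUTchII] Cor 4.10 (vi) — the NV-L6 row «ThetaGauChain»: the inhabitation condition DECIDED over ANY setting
# (the strip package of Cor 4.10 (i)–(iv) as a Σ-type; positive and negative mechanisms; the exact decision)

Mochizuki, *Inter-universal Teichmüller Theory II*, kurims manuscript (Dec 2020), §4, Cor 4.10 (i)–(iv) pp. 158–160,
(vi) p. 161 ("a collection of distinct `Θ^{±ell}NF`-Hodge theaters indexed by the integers", the infinite chain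
`… ⟶ ⁽ⁿ⁻¹⁾HT ⟶ ⁿHT ⟶ ⁽ⁿ⁺¹⁾HT ⟶ …` of `Θ^{×μ}_{gau}`-links). PROOF-ONLY companion (no `def`, no `instance`, no `structure`) of
abc-iut-w5-d193's `ThetaGauChainNonVacuity.lean` (p419396), which left the GENUINE-frame instance of abc-iut-L6-t2's interface
`ThetaGauChain S` (`ThetaGauLinks.lean`) as the criterion `ThetaGauChain.nonempty_iff_infinite` — chain iff
`Infinite (HodgeTheaterStrips S)` — beside a DEGENERATE one-object witness. L6-lead §F v1.19a (3) «genuine-frame UPGRADES of the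
degenerate witnesses» (row NV-L6-UPGRADE ThetaGauChain@ofKits, abc-iut-w5-d193 gen 3): this file is part 1 (ANY setting
`S : ThetaLinkSetting FV FVM FUM DM`); part 2 (`ThetaGauChainOfKits.lean`) reads it on abc-iut-L6-t3's frame-induced setting
`ThetaLinkSetting.ofStripFrame`, on `StripFrame.ofKits`, and DECIDES it at the landed toy kit.

* `HodgeTheaterStrips.nonempty_equiv_sigma` — a strip package ([IUTchII] Cor 4.10 (i)–(iv): five `F^⊩`-prime-strips, three
  identification/evaluation isomorphisms, two unit-portion isomorphisms of `F^{⊢×μ}`-prime-strips) is EXACTLY a point of the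
  Σ-type of those ten data;
* `HodgeTheaterStrips.nonempty_of_obj` — the interface `HodgeTheaterStrips` (abc-iut-w5-d114 census: field-only record) is
  inhabited over every setting with an `F^⊩`-prime-strip (one theater's five strips identified along identities);
* POSITIVE mechanisms: `…infinite_of_infinite_obj` (infinitely many `F^⊩`-prime-strips), `…_of_infinite_fibre` (one quintuple
  of strips with infinitely many isomorphism data), `…_of_infinite_aut` (ONE `F^⊩`-prime-strip with infinitely many
  automorphisms — vary `†F^⊩_△ ⥲ †F^⊩_mod`), `…_of_infinite_unitAut` (ONE `F^{⊢×μ}`-prime-strip with infinitely many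
  automorphisms — vary the unit-portion isomorphism `†F^{⊢×μ}_△ ⥲ †F^{⊢×μ}_env`); NEGATIVE: `HodgeTheaterStrips.finite_of_finite`
  (finitely many strips with finite isomorphism types ⇒ finitely many packages);
* `ThetaGauChain.nonempty_iff_infinite_obj_or_fibre` — **THE EXACT DECISION**: a chain of DISTINCT theaters exists iff EITHER
  there are infinitely many `F^⊩`-prime-strips OR some quintuple of strips carries infinitely many (identification, evaluation,
  unit-portion)-isomorphism data; corollaries `ThetaGauChain.nonempty_of_infinite_obj/_aut/_unitAut`,
  `ThetaGauChain.isEmpty_of_finite`, `…not_nonempty_of_finite`.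

HONEST LABEL: mechanism theorems over the abstract interface; no object of the series is constructed here. Nothing of
[IUTchII]/[IUTchIII] is asserted; typed ≠ proved; no side is taken on [IUTchIII] Cor 3.12. [claim: Mochizuki2012, status: disputed]
-/

/-! ### 1. Any setting: the strip package of Cor 4.10 (i)–(iv) as a Σ-type; the exact decision for Cor 4.10 (vi) -/

namespace Literature.IUT.HodgeArakelov

open CategoryTheory

universe v₁ v₂ v₃ v₄ u₁ u₂ u₃ u₄

section AnySetting

variable {FV : Type u₁} [Category.{v₁} FV] {FVM : Type u₂} [Category.{v₂} FVM]
  {FUM : Type u₃} [Category.{v₃} FUM] {DM : Type u₄} [Category.{v₄} DM]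
  (S : ThetaLinkSetting FV FVM FUM DM)

namespace HodgeTheaterStrips

/-- **IUTchII:Cor4.10(i)** (kurims p.158) The strip package `(†F^⊩_△, †F^⊩_mod, †F^⊩_env, †F^⊩_tht, †F^⊩_gau; †F^⊩_△ ⥲ †F^⊩_mod,
†F^⊩_env ⥲ †F^⊩_tht, †F^⊩_env ⥲ †F^⊩_gau; †F^{⊢×μ}_△ ⥲ †F^{⊢×μ}_env ⥲ †F^{⊢×μ}_gau)` of Cor 4.10 (i)–(iv) IS a point of the Σ-type of
these ten data (the record, unbundled): an equivalence of types. [claim: Mochizuki2012, status: disputed] -/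
theorem nonempty_equiv_sigma :
    Nonempty (HodgeTheaterStrips S ≃
      Σ (d : FV) (f : FV) (e : FV) (t : FV) (g : FV),
        (d ≅ f) × (e ≅ t) × (e ≅ g) ×
          (S.toUnitMu.obj (S.toVdashMu.obj d) ≅ S.toUnitMu.obj (S.toVdashMu.obj e)) ×
            (S.toUnitMu.obj (S.toVdashMu.obj e) ≅ S.toUnitMu.obj (S.toVdashMu.obj g))) :=
  ⟨{ toFun := fun T => ⟨T.delta, T.fmod, T.env, T.tht, T.gau, T.deltaIsoMod, T.envIsoTht, T.evalIso,
        T.unitDeltaIsoEnv, T.unitEnvIsoGau⟩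
     invFun := fun x =>
       { delta := x.1, fmod := x.2.1, env := x.2.2.1, tht := x.2.2.2.1, gau := x.2.2.2.2.1
         deltaIsoMod := x.2.2.2.2.2.1, envIsoTht := x.2.2.2.2.2.2.1, evalIso := x.2.2.2.2.2.2.2.1
         unitDeltaIsoEnv := x.2.2.2.2.2.2.2.2.1, unitEnvIsoGau := x.2.2.2.2.2.2.2.2.2 }
     left_inv := fun _ => rfl
     right_inv := fun _ => rfl }⟩

/-- **IUTchII:Cor4.10(i)** (kurims p.158) The interface `HodgeTheaterStrips S` is INHABITED over every setting with an `F^⊩`-prime-strip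
`X`: all five strips `:= X`, all five isomorphisms `:=` identities (the strips of ONE theater identified along the "natural
identification isomorphisms"; the census's field-only record, witnessed). [claim: Mochizuki2012, status: disputed] -/
theorem nonempty_of_obj (X : FV) : Nonempty (HodgeTheaterStrips S) :=
  ⟨{ delta := X, fmod := X, env := X, tht := X, gau := X
     deltaIsoMod := Iso.refl X, envIsoTht := Iso.refl X, evalIso := Iso.refl X
     unitDeltaIsoEnv := Iso.refl _, unitEnvIsoGau := Iso.refl _ }⟩

/-- **IUTchII:Cor4.10(vi)** (kurims p.161) Infinitely many `F^⊩`-prime-strips give infinitely many DISTINCT strip packages (the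
package of the previous item at each strip; packages with distinct `†F^⊩_△` are distinct). [claim: Mochizuki2012, status: disputed] -/
theorem infinite_of_infinite_obj [Infinite FV] : Infinite (HodgeTheaterStrips S) :=
  Infinite.of_injective
    (fun X : FV =>
      ({ delta := X, fmod := X, env := X, tht := X, gau := X
         deltaIsoMod := Iso.refl X, envIsoTht := Iso.refl X, evalIso := Iso.refl X
         unitDeltaIsoEnv := Iso.refl _, unitEnvIsoGau := Iso.refl _ } : HodgeTheaterStrips S))
    fun _ _ h => congrArg HodgeTheaterStrips.delta h

/-- **IUTchII:Cor4.10(vi)** (kurims p.161) An infinite fibre of the Σ-type — ONE quintuple of `F^⊩`-prime-strips carrying infinitely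
many (identification, evaluation, unit-portion)-isomorphism data — gives infinitely many distinct strip packages.
[claim: Mochizuki2012, status: disputed] -/
theorem infinite_of_infinite_fibre (d f e t g : FV)
    (h : Infinite ((d ≅ f) × (e ≅ t) × (e ≅ g) ×
      (S.toUnitMu.obj (S.toVdashMu.obj d) ≅ S.toUnitMu.obj (S.toVdashMu.obj e)) ×
        (S.toUnitMu.obj (S.toVdashMu.obj e) ≅ S.toUnitMu.obj (S.toVdashMu.obj g)))) :
    Infinite (HodgeTheaterStrips S) := by
  haveI := h
  obtain ⟨ε⟩ := nonempty_equiv_sigma S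
  refine Infinite.of_injective (fun x => ε.symm ⟨d, f, e, t, g, x⟩) ?_
  intro x y hxy
  have h' := ε.symm.injective hxy
  simp only [Sigma.mk.injEq, heq_eq_eq, true_and] at h'
  exact h'

/-- **IUTchII:Cor4.10(vi)** (kurims p.161) ONE `F^⊩`-prime-strip with infinitely many automorphisms gives infinitely many distinct
strip packages (vary the identification isomorphism `†F^⊩_△ ⥲ †F^⊩_mod`; abc-iut-w5-d193's mechanism
`ThetaGauChain.infinite_strips_of_injective` at the identity-package). [claim: Mochizuki2012, status: disputed] -/
theorem infinite_of_infinite_aut (X : FV) (h : Infinite (X ≅ X)) : Infinite (HodgeTheaterStrips S) :=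
  haveI := h
  ThetaGauChain.infinite_strips_of_injective S
    { delta := X, fmod := X, env := X, tht := X, gau := X
      deltaIsoMod := Iso.refl X, envIsoTht := Iso.refl X, evalIso := Iso.refl X
      unitDeltaIsoEnv := Iso.refl _, unitEnvIsoGau := Iso.refl _ }
    (ι := (X ≅ X)) (fun e => e) fun _ _ h => h

/-- **IUTchII:Cor4.10(vi)** (kurims p.161) ONE `F^{⊢×μ}`-prime-strip `†F^{⊢×μ}_△` with infinitely many automorphisms gives infinitely
many distinct strip packages (vary the unit-portion isomorphism `†F^{⊢×μ}_△ ⥲ †F^{⊢×μ}_env` of Cor 4.10 (iv)).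
[claim: Mochizuki2012, status: disputed] -/
theorem infinite_of_infinite_unitAut (X : FV)
    (h : Infinite (S.toUnitMu.obj (S.toVdashMu.obj X) ≅ S.toUnitMu.obj (S.toVdashMu.obj X))) :
    Infinite (HodgeTheaterStrips S) := by
  haveI := h
  refine infinite_of_infinite_fibre S X X X X X (Infinite.of_injective
    (fun u => (Iso.refl X, Iso.refl X, Iso.refl X, u, Iso.refl _)) ?_)
  intro u u' huu
  simp only [Prod.mk.injEq, true_and, and_true] at huu
  exact huu

/-- **IUTchII:Cor4.10(vi)** (kurims p.161) NEGATIVE mechanism: finitely many `F^⊩`-prime-strips with finite isomorphism types (of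
the strips and of their `F^{⊢×μ}`-prime-strips) give only finitely many strip packages. [claim: Mochizuki2012, status: disputed] -/
theorem finite_of_finite [Finite FV] [∀ X Y : FV, Finite (X ≅ Y)]
    [∀ X Y : FV, Finite (S.toUnitMu.obj (S.toVdashMu.obj X) ≅ S.toUnitMu.obj (S.toVdashMu.obj Y))] :
    Finite (HodgeTheaterStrips S) := by
  obtain ⟨ε⟩ := nonempty_equiv_sigma S
  exact Finite.of_equiv _ ε.symm

end HodgeTheaterStrips

namespace ThetaGauChain

/-- **IUTchII:Cor4.10(vi)** (kurims p.161) **THE EXACT DECISION.** A collection of DISTINCT `Θ^{±ell}NF`-Hodge theaters indexed by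
`ℤ` (through their strips) exists over the setting `S` iff EITHER there are infinitely many `F^⊩`-prime-strips OR some quintuple of
`F^⊩`-prime-strips carries infinitely many (identification, evaluation, unit-portion)-isomorphism data
(abc-iut-w5-d193's `nonempty_iff_infinite` + the Σ-description of the strip package). [claim: Mochizuki2012, status: disputed] -/
theorem nonempty_iff_infinite_obj_or_fibre :
    Nonempty (ThetaGauChain S) ↔
      Infinite FV ∨ ∃ d f e t g : FV, Infinite ((d ≅ f) × (e ≅ t) × (e ≅ g) ×
        (S.toUnitMu.obj (S.toVdashMu.obj d) ≅ S.toUnitMu.obj (S.toVdashMu.obj e)) ×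
          (S.toUnitMu.obj (S.toVdashMu.obj e) ≅ S.toUnitMu.obj (S.toVdashMu.obj g))) := by
  rw [nonempty_iff_infinite]
  refine ⟨fun h => ?_, ?_⟩
  · by_contra hne
    obtain ⟨h1, h2⟩ := not_or.mp hne
    simp only [not_exists, not_infinite_iff_finite] at h2
    haveI : Finite FV := not_infinite_iff_finite.mp h1
    haveI := h2
    obtain ⟨ε⟩ := HodgeTheaterStrips.nonempty_equiv_sigma S
    haveI : Finite (HodgeTheaterStrips S) := Finite.of_equiv _ ε.symm
    haveI := h
    exact not_finite (HodgeTheaterStrips S)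
  · rintro (h | ⟨d, f, e, t, g, h⟩)
    · haveI := h
      exact HodgeTheaterStrips.infinite_of_infinite_obj S
    · exact HodgeTheaterStrips.infinite_of_infinite_fibre S d f e t g h

/-- **IUTchII:Cor4.10(vi)** (kurims p.161) Infinitely many `F^⊩`-prime-strips ⇒ a chain of distinct `Θ^{±ell}NF`-Hodge theaters.
[claim: Mochizuki2012, status: disputed] -/
theorem nonempty_of_infinite_obj [Infinite FV] : Nonempty (ThetaGauChain S) :=
  (nonempty_iff_infinite S).mpr (HodgeTheaterStrips.infinite_of_infinite_obj S)

/-- **IUTchII:Cor4.10(vi)** (kurims p.161) ONE `F^⊩`-prime-strip with infinitely many automorphisms ⇒ a chain.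
[claim: Mochizuki2012, status: disputed] -/
theorem nonempty_of_infinite_aut (X : FV) (h : Infinite (X ≅ X)) : Nonempty (ThetaGauChain S) :=
  (nonempty_iff_infinite S).mpr (HodgeTheaterStrips.infinite_of_infinite_aut S X h)

/-- **IUTchII:Cor4.10(vi)** (kurims p.161) ONE `F^{⊢×μ}`-prime-strip `†F^{⊢×μ}_△` with infinitely many automorphisms ⇒ a chain.
[claim: Mochizuki2012, status: disputed] -/
theorem nonempty_of_infinite_unitAut (X : FV)
    (h : Infinite (S.toUnitMu.obj (S.toVdashMu.obj X) ≅ S.toUnitMu.obj (S.toVdashMu.obj X))) :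
    Nonempty (ThetaGauChain S) :=
  (nonempty_iff_infinite S).mpr (HodgeTheaterStrips.infinite_of_infinite_unitAut S X h)

/-- **IUTchII:Cor4.10(vi)** (kurims p.161) NEGATIVE: finitely many `F^⊩`-prime-strips with finite isomorphism types ⇒ NO collection
of distinct `Θ^{±ell}NF`-Hodge theaters indexed by `ℤ`. [claim: Mochizuki2012, status: disputed] -/
theorem isEmpty_of_finite [Finite FV] [∀ X Y : FV, Finite (X ≅ Y)]
    [∀ X Y : FV, Finite (S.toUnitMu.obj (S.toVdashMu.obj X) ≅ S.toUnitMu.obj (S.toVdashMu.obj Y))] :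
    IsEmpty (ThetaGauChain S) :=
  ⟨fun P =>
    haveI := (nonempty_iff_infinite S).mp ⟨P⟩
    haveI := HodgeTheaterStrips.finite_of_finite S
    not_finite (HodgeTheaterStrips S)⟩

/-- **IUTchII:Cor4.10(vi)** (kurims p.161) … equivalently `¬ Nonempty (ThetaGauChain S)`. [claim: Mochizuki2012, status: disputed] -/
theorem not_nonempty_of_finite [Finite FV] [∀ X Y : FV, Finite (X ≅ Y)]
    [∀ X Y : FV, Finite (S.toUnitMu.obj (S.toVdashMu.obj X) ≅ S.toUnitMu.obj (S.toVdashMu.obj Y))] :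
    ¬ Nonempty (ThetaGauChain S) :=
  not_nonempty_iff.mpr (isEmpty_of_finite S)

end ThetaGauChain

/-- **IUTchII:Cor4.10(i)** (kurims p.158) Isomorphism types of a category with finite `Hom`-types are finite (an isomorphism is
determined by its underlying morphism). (plumbing) [claim: Mochizuki2012, status: disputed] -/
theorem HodgeTheaterStrips.finite_iso_of_finite_hom {C : Type u₁} [Category.{v₁} C] (X Y : C) [Finite (X ⟶ Y)] :
    Finite (X ≅ Y) :=
  Finite.of_injective Iso.hom fun _ _ h => Iso.ext h

end AnySetting

end Literature.IUT.HodgeArakelov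

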